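import Mathlib
import Literature.NumberTheory.Transcendental.KZCalculusProofs
import Literature.NumberTheory.Transcendental.KZLogCalculusProofs
import Literature.NumberTheory.Transcendental.KZSemiCanonicalReductionProofs
import Summits.KontsevichZagierPeriods.KontsevichZagierPeriods.Theorems.HyperbolicBlochOffTetraSectorKernelStubSimilarityMove
import Summits.KontsevichZagierPeriods.KontsevichZagierPeriods.Theorems.HyperbolicBlochOffTetraSectorKernelRungZeroIntervals
import Summits.KontsevichZagierPeriods.KontsevichZagierPeriods.Theorems.HyperbolicBlochOffTetraSectorKernelStubAngleKernelAlgebra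
import Summits.KontsevichZagierPeriods.KontsevichZagierPeriods.Theorems.HyperbolicBlochOffTetraSectorKernelStubVPiece
import Summits.KontsevichZagierPeriods.KontsevichZagierPeriods.Theorems.LinRedNormalFormArrangementNormalFormStubRebaseOneTools

/-!
# Stub `stub_angleKernel` — crux `OffTetraSectorKernel`, line `odd-hyperbolic-ladder` (skeleton v4, lead c3)

Rung 1 of the hyperbolic scissors ladder (areas of `ℚ̄`-geodesic polygons of the hyperbolic plane, upper
half-plane model `p : Fin 2 → ℝ`, `x = p 0`, `t = p 1`, density `t⁻²`): **every `ℤ`-linear relation among areas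
of V-pieces `V α β a c = {α < x < β, 0 < t, c < (x − a)² + t²}` is a Kontsevich–Zagier relation.**

* §1 (landed separately: `…StubAngleKernelAlgebra.lean`) ANGLE ALGEBRA of the standard doubly-ideal triangles `Std γ = V γ 1 0 1` (area `arccos γ`): from the
  three-triangle relation (`stub_threeTriangles`, a hypothesis here) the classes `U θ = [Std (cos θ)]` add like
  angles — `U A + U B ≡ U (A + B)` for `A + B ≤ π` and `U A + U B ≡ U π + U (A + B − π)` beyond — so every finite
  sum of them is a MULTI-TURN CLASS `q • U π + U θ` (`θ ∈ [0, π)`) determined by the total angle alone; a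
  `ℤ`-relation among the angles makes the positive and the negative side the same multi-turn class
  (`angleKernel_stdKernel`). The value relation is used exactly once, as the equality of two real numbers
  (cf. `Cruxes/OffTetraSectorKernel/Disproof.lean`, `false_without_evalZero`); no transcendence input.
* §2 NORMAL FORM: one boundary similarity `x ↦ (x − a)/√c`, `t ↦ t/√c` (rule (2), landed `stub_similarityMove`)
  and one domain-additivity move (rule (1a)) give `[V α β a c] ≡ [Std ((α−a)/√c)] − [Std ((β−a)/√c)]`.
* §3 the registered stub `stub_angleKernel`.

References: M. Kontsevich, D. Zagier, *Periods* (2001), §1.2; J. Ratcliffe, *Foundations of hyperbolic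
manifolds*, §3.5 (area of geodesic polygons); W. D. Neumann, *Hilbert's 3rd problem and invariants of
3-manifolds* (1998), §2 (scissors congruence ladder).
-/

noncomputable section

open Set MeasureTheory Real
open Literature.NumberTheory.Transcendental

namespace Summit.KontsevichZagierPeriods.HyperbolicBloch.OffTetraSectorKernel

/-! ### §2 Normal form of a V-piece -/

section NormalForm

variable {V : ℝ → ℝ → ℝ → ℝ → Set (Fin 2 → ℝ)}
  (hV : ∀ α β a c, V α β a c = {p | α < p 0 ∧ p 0 < β ∧ 0 < p 1 ∧ c < (p 0 - a) ^ 2 + p 1 ^ 2})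
include hV

omit hV in
/-- `(u − a)² ≤ c`, `0 < c` ⟹ `−1 ≤ (u − a)/√c ≤ 1`. [folklore] -/
theorem angleKernel_normalised_mem {u a c : ℝ} (hc : 0 < c) (hu : (u - a) ^ 2 ≤ c) :
    -1 ≤ (u - a) * (Real.sqrt c)⁻¹ ∧ (u - a) * (Real.sqrt c)⁻¹ ≤ 1 := by
  have hR : 0 < Real.sqrt c := Real.sqrt_pos.mpr hc
  have habs : |u - a| ≤ Real.sqrt c := by
    rw [← Real.sqrt_sq_eq_abs]
    exact Real.sqrt_le_sqrt hu
  rw [abs_le] at habs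
  rw [← div_eq_mul_inv, le_div_iff₀ hR, div_le_iff₀ hR]
  constructor <;> linarith

omit hV in
/-- The boundary similarity `(x, t) ↦ ((x − a)/√c, t/√c)` in the `Fin.snoc` form of `stub_similarityMove`
(`n = 1`, scale `(√c)⁻¹`, `A = 1`, translation `−a/√c`): its two components. [folklore] -/
theorem angleKernel_simil_apply (a c : ℝ) (p : Fin 2 → ℝ) :
    (Fin.snoc (α := fun _ => ℝ) ((Real.sqrt c)⁻¹ • (1 : Matrix (Fin 1) (Fin 1) ℝ).mulVec (Fin.init p) +
        ![-a * (Real.sqrt c)⁻¹]) ((Real.sqrt c)⁻¹ * p (Fin.last 1)) : Fin 2 → ℝ) 0 =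
        (p 0 - a) * (Real.sqrt c)⁻¹ ∧
      (Fin.snoc (α := fun _ => ℝ) ((Real.sqrt c)⁻¹ • (1 : Matrix (Fin 1) (Fin 1) ℝ).mulVec (Fin.init p) +
        ![-a * (Real.sqrt c)⁻¹]) ((Real.sqrt c)⁻¹ * p (Fin.last 1)) : Fin 2 → ℝ) 1 =
        p 1 * (Real.sqrt c)⁻¹ := by
  constructor
  · simp [Fin.snoc, Matrix.one_mulVec, Fin.init]
    ring
  · simp [Fin.snoc]
    ring

/-- The similarity `(x, t) ↦ ((x − a)/√c, t/√c)` maps the V-piece `V α β a c` onto the normalised V-piece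
`V ((α−a)/√c) ((β−a)/√c) 0 1`. [cite: KontsevichZagier2001, §1.2 rule (2)] -/
theorem angleKernel_simil_image {α β a c : ℝ} (hc : 0 < c) :
    (fun p : Fin 2 → ℝ => (Fin.snoc (α := fun _ => ℝ)
      ((Real.sqrt c)⁻¹ • (1 : Matrix (Fin 1) (Fin 1) ℝ).mulVec (Fin.init p) + ![-a * (Real.sqrt c)⁻¹])
      ((Real.sqrt c)⁻¹ * p (Fin.last 1)) : Fin 2 → ℝ)) '' V α β a c =
      V ((α - a) * (Real.sqrt c)⁻¹) ((β - a) * (Real.sqrt c)⁻¹) 0 1 := by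
  have hR : 0 < Real.sqrt c := Real.sqrt_pos.mpr hc
  have hR2 : Real.sqrt c ^ 2 = c := Real.sq_sqrt hc.le
  have hRi : 0 < (Real.sqrt c)⁻¹ := inv_pos.mpr hR
  ext q
  simp only [hV, mem_image, mem_setOf_eq]
  constructor
  · rintro ⟨p, ⟨h1, h2, h3, h4⟩, rfl⟩
    obtain ⟨e0, e1⟩ := angleKernel_simil_apply a c p
    rw [e0, e1]
    refine ⟨mul_lt_mul_of_pos_right (by linarith) hRi, mul_lt_mul_of_pos_right (by linarith) hRi,
      mul_pos h3 hRi, ?_⟩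
    have : ((p 0 - a) * (Real.sqrt c)⁻¹ - 0) ^ 2 + (p 1 * (Real.sqrt c)⁻¹) ^ 2 =
        ((p 0 - a) ^ 2 + p 1 ^ 2) / c := by
      rw [sub_zero, mul_pow, mul_pow, inv_pow, hR2]
      ring
    rw [this, lt_div_iff₀ hc, one_mul]
    exact h4
  · rintro ⟨h1, h2, h3, h4⟩
    refine ⟨![q 0 * Real.sqrt c + a, q 1 * Real.sqrt c], ⟨?_, ?_, ?_, ?_⟩, ?_⟩
    · have := mul_lt_mul_of_pos_right h1 hR
      simp only [Matrix.cons_val_zero]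
      rw [mul_assoc, inv_mul_cancel₀ hR.ne', mul_one] at this
      linarith
    · have := mul_lt_mul_of_pos_right h2 hR
      simp only [Matrix.cons_val_zero]
      rw [mul_assoc, inv_mul_cancel₀ hR.ne', mul_one] at this
      linarith
    · simp only [Matrix.cons_val_one, Matrix.cons_val_zero]
      exact mul_pos h3 hR
    · simp only [Matrix.cons_val_zero, Matrix.cons_val_one]
      have : (q 0 * Real.sqrt c + a - a) ^ 2 + (q 1 * Real.sqrt c) ^ 2 = ((q 0 - 0) ^ 2 + q 1 ^ 2) * c := by
        rw [add_sub_cancel_right, sub_zero, mul_pow, mul_pow, hR2]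
        ring
      rw [this]
      nlinarith
    · obtain ⟨e0, e1⟩ := angleKernel_simil_apply a c ![q 0 * Real.sqrt c + a, q 1 * Real.sqrt c]
      simp only [Matrix.cons_val_zero, Matrix.cons_val_one] at e0 e1
      rw [funext_iff, Fin.forall_fin_two]
      refine ⟨e0.trans ?_, e1.trans ?_⟩
      · field_simp
        ring
      · field_simp

/-- **One boundary similarity**: a V-piece representation is KZ-equivalent to any representation of the
normalised V-piece (landed `stub_similarityMove`, rule (2), with `n = 1`, scale `1/√c`, `A = 1`,
translation `−a/√c`). [cite: KontsevichZagier2001, §1.2 rule (2)] -/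
theorem angleKernel_equivalent_normalised {α β a c : ℝ} (hc : 0 < c) (ha : IsAlgebraic ℚ a)
    (hcalg : IsAlgebraic ℚ c) (W r' : KZ.IntegralRep 2) (hW : W.domain = V α β a c)
    (hWi : EqOn W.integrand (fun p => 1 / p 1 ^ 2) W.domain)
    (hr' : r'.domain = V ((α - a) * (Real.sqrt c)⁻¹) ((β - a) * (Real.sqrt c)⁻¹) 0 1)
    (hr'i : EqOn r'.integrand (fun p => 1 / p 1 ^ 2) r'.domain) : KZ.Equivalent W r' := by
  have hR : 0 < Real.sqrt c := Real.sqrt_pos.mpr hc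
  have hsalg : IsAlgebraic ℚ (Real.sqrt c)⁻¹ := (rungZero_isAlgebraic_sqrt hcalg).inv
  refine stub_similarityMove 1 (Real.sqrt c)⁻¹ 1 ![-a * (Real.sqrt c)⁻¹] hsalg (inv_pos.mpr hR)
    (fun i j => ?_) (by simp) (fun i => ?_) W r' (fun p hp => ?_) (fun p hp => ?_) ?_ (fun p hp => ?_)
  · rw [Matrix.one_apply]
    split_ifs
    · exact isAlgebraic_one
    · exact isAlgebraic_zero
  · fin_cases i
    simpa using (ha.neg.mul hsalg)
  · rw [hW, hV] at hp
    exact hp.2.2.1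
  · rw [hWi hp]
    rfl
  · rw [hr', hW, angleKernel_simil_image hV hc]
  · rw [hr'i hp]
    rfl

/-- **One domain-additivity move**: `[Std α'] − [V α' β' 0 1] − [Std β'] ∈ relations` for `α' < β' ≤ 1`
(the standard triangle `Std α' = V α' 1 0 1` is the disjoint union of the two pieces and the null vertical
segment `x = β'`). [cite: KontsevichZagier2001, §1.2 rule (1)] -/
theorem angleKernel_split_std {α' β' : ℝ} (hαβ : α' < β') (hβ : β' ≤ 1) (Sα r' Sβ : KZ.IntegralRep 2)
    (hSα : Sα.domain = V α' 1 0 1) (hSαi : EqOn Sα.integrand (fun p => 1 / p 1 ^ 2) Sα.domain)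
    (hr' : r'.domain = V α' β' 0 1) (hr'i : EqOn r'.integrand (fun p => 1 / p 1 ^ 2) r'.domain)
    (hSβ : Sβ.domain = V β' 1 0 1) (hSβi : EqOn Sβ.integrand (fun p => 1 / p 1 ^ 2) Sβ.domain) :
    KZ.of Sα - KZ.of r' - KZ.of Sβ ∈ KZ.relations := by
  classical
  have hsub1 : r'.domain ⊆ Sα.domain := by
    rw [hr', hSα, hV, hV]
    rintro p ⟨h1, h2, h3, h4⟩
    exact ⟨h1, by linarith, h3, h4⟩
  have hsub2 : Sβ.domain ⊆ Sα.domain := by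
    rw [hSβ, hSα, hV, hV]
    rintro p ⟨h1, h2, h3, h4⟩
    exact ⟨by linarith, h2, h3, h4⟩
  have key := KZ.of_sub_sum_of_mem_relations (Finset.univ : Finset (Fin 2)) Sα ![r', Sβ]
    (fun i _ => ?_) (fun i _ => ?_) ?_ ?_
  · simpa [Fin.sum_univ_two, sub_sub] using key
  · fin_cases i
    · simp [Set.sdiff_eq_empty.mpr hsub1]
    · simp [Set.sdiff_eq_empty.mpr hsub2]
  · fin_cases i
    · intro p hp
      simp only [Fin.zero_eta, Fin.isValue, Matrix.cons_val_zero] at hp ⊢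
      rw [hr'i hp.1, hSαi hp.2]
    · intro p hp
      simp only [Fin.mk_one, Fin.isValue, Matrix.cons_val_one, Matrix.cons_val_zero] at hp ⊢
      rw [hSβi hp.1, hSαi hp.2]
  · refine measure_mono_null (fun p hp => ?_) (Summit.KontsevichZagierPeriods.ArrangementNormalForm.JanusBands.RebaseOne.volume_vline β')
    simp only [Finset.mem_univ, iUnion_true, Set.mem_sdiff, mem_iUnion, not_exists] at hp
    obtain ⟨hpS, hnot⟩ := hp
    have h0 := hnot 0
    have h1 := hnot 1
    simp only [Fin.isValue, Matrix.cons_val_zero, Matrix.cons_val_one] at h0 h1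
    rw [hr', hV] at h0
    rw [hSβ, hV] at h1
    rw [hSα, hV] at hpS
    simp only [mem_setOf_eq, not_and] at h0 h1 hpS ⊢
    obtain ⟨q1, q2, q3, q4⟩ := hpS
    by_contra hne
    rcases lt_or_gt_of_ne hne with hlt | hgt
    · exact h0 q1 hlt q3 q4
    · exact h1 hgt q2 q3 q4
  · intro i _ j _ hij
    have hdis : (r'.domain ∩ Sβ.domain) = ∅ := by
      rw [hr', hSβ, hV, hV]
      ext p
      simp only [mem_inter_iff, mem_setOf_eq, mem_empty_iff_false, iff_false, not_and]
      rintro ⟨-, h2, -, -⟩ hb - - -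
      linarith
    fin_cases i <;> fin_cases j
    · exact absurd rfl hij
    · simp [hdis]
    · simp [inter_comm, hdis]
    · exact absurd rfl hij

end NormalForm

/-! ### §3 The registered stub -/

/-- The third argument of the three-triangle relation lies in `[−1, 1]` (it is `cos (π − arccos a − arccos b)`).
[folklore] -/
theorem angleKernel_third_mem {a b : ℝ} (ha1 : -1 ≤ a) (ha2 : a ≤ 1) (hb1 : -1 ≤ b) (hb2 : b ≤ 1) :
    -1 ≤ Real.sqrt (1 - a ^ 2) * Real.sqrt (1 - b ^ 2) - a * b ∧
      Real.sqrt (1 - a ^ 2) * Real.sqrt (1 - b ^ 2) - a * b ≤ 1 := by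
  have h := angleKernel_third_cos (A := arccos a) (B := arccos b) (arccos_nonneg a) (arccos_le_pi a)
    (arccos_nonneg b) (arccos_le_pi b)
  rw [cos_arccos ha1 ha2, cos_arccos hb1 hb2] at h
  rw [h]
  exact ⟨neg_one_le_cos _, cos_le_one _⟩

/-- **STUB `stub_angleKernel`** (lead, skeleton v4 of line `odd-hyperbolic-ladder`): every `ℤ`-linear relation
among areas of V-pieces of the hyperbolic plane is a Kontsevich–Zagier relation. Normal form by one boundary
similarity and one domain-additivity move (`[V α β a c] ≡ [Std α'] − [Std β']`), then the angle kernel for the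
standard classes (`angleKernel_std_kernel_aux`); the value relation is spent once, as the equality of the two
total angles. [cite: KontsevichZagier2001, §1.2] -/
theorem stub_angleKernel :
    ∀ (V : ℝ → ℝ → ℝ → ℝ → Set (Fin 2 → ℝ)),
      (∀ α β a c, V α β a c = {p | α < p 0 ∧ p 0 < β ∧ 0 < p 1 ∧ c < (p 0 - a) ^ 2 + p 1 ^ 2}) →
    -- `stub_threeTriangles`
    (∀ (a b : ℝ), IsAlgebraic ℚ a → IsAlgebraic ℚ b → -1 < a → a < 1 → -1 < b → b < 1 → 0 ≤ a + b →
      ∀ (ra rb rc rπ : KZ.IntegralRep 2),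
      ra.domain = V a 1 0 1 → EqOn ra.integrand (fun p => 1 / p 1 ^ 2) ra.domain →
      rb.domain = V b 1 0 1 → EqOn rb.integrand (fun p => 1 / p 1 ^ 2) rb.domain →
      rc.domain = V (Real.sqrt (1 - a ^ 2) * Real.sqrt (1 - b ^ 2) - a * b) 1 0 1 →
        EqOn rc.integrand (fun p => 1 / p 1 ^ 2) rc.domain →
      rπ.domain = V (-1) 1 0 1 → EqOn rπ.integrand (fun p => 1 / p 1 ^ 2) rπ.domain →
      KZ.of ra + KZ.of rb + KZ.of rc - KZ.of rπ ∈ KZ.relations) →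
    -- `stub_vPiece`
    (∀ α β a c : ℝ, IsAlgebraic ℚ α → IsAlgebraic ℚ β → IsAlgebraic ℚ a → IsAlgebraic ℚ c →
        α < β → (α - a) ^ 2 ≤ c → (β - a) ^ 2 ≤ c →
        ∃ r : KZ.IntegralRep 2, r.domain = V α β a c ∧ r.integrand = fun p => 1 / p 1 ^ 2) →
    (∀ γ : ℝ, -1 ≤ γ → γ ≤ 1 → ∀ r : KZ.IntegralRep 2, r.domain = V γ 1 0 1 →
        EqOn r.integrand (fun p => 1 / p 1 ^ 2) r.domain → r.value = Real.arccos γ) →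
    ∀ (ι : Type) [Fintype ι] (α β a c : ι → ℝ) (E : ι → ℤ) (W : ι → KZ.IntegralRep 2),
      (∀ l, IsAlgebraic ℚ (α l) ∧ IsAlgebraic ℚ (β l) ∧ IsAlgebraic ℚ (a l) ∧ IsAlgebraic ℚ (c l) ∧
        α l < β l ∧ (α l - a l) ^ 2 ≤ c l ∧ (β l - a l) ^ 2 ≤ c l) →
      (∀ l, (W l).domain = V (α l) (β l) (a l) (c l) ∧ EqOn (W l).integrand (fun p => 1 / p 1 ^ 2) (W l).domain) →
      ∑ l, (E l : ℝ) * (W l).value = 0 →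
      ∑ l, E l • KZ.of (W l) ∈ KZ.relations := by
  intro V hV hT hRep hVal ι _ α β a c E W hdata hW hsum
  classical
  /- the standard family `S γ` on `Std γ = V γ 1 0 1` -/
  have key : ∃ S : ℝ → KZ.IntegralRep 2, ∀ γ, IsAlgebraic ℚ γ → -1 ≤ γ → γ ≤ 1 →
      (S γ).domain = V γ 1 0 1 ∧ EqOn (S γ).integrand (fun p => 1 / p 1 ^ 2) (S γ).domain := by
    have hex : ∀ γ, IsAlgebraic ℚ γ ∧ -1 ≤ γ ∧ γ < 1 →
        ∃ r : KZ.IntegralRep 2, r.domain = V γ 1 0 1 ∧ r.integrand = fun p => 1 / p 1 ^ 2 :=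
      fun γ h => hRep γ 1 0 1 h.1 isAlgebraic_one isAlgebraic_zero isAlgebraic_one h.2.2
        (by rw [sub_zero]; nlinarith [h.2.1, h.2.2]) (by norm_num)
    refine ⟨fun γ => if h : IsAlgebraic ℚ γ ∧ -1 ≤ γ ∧ γ < 1 then Classical.choose (hex γ h)
      else KZ.IntegralRep.empty 2, fun γ hγ h1 h2 => ?_⟩
    by_cases hlt : γ < 1
    · have h : IsAlgebraic ℚ γ ∧ -1 ≤ γ ∧ γ < 1 := ⟨hγ, h1, hlt⟩
      simp only [dif_pos h]
      obtain ⟨hd, hi⟩ := Classical.choose_spec (hex γ h)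
      exact ⟨hd, fun p _ => by rw [hi]⟩
    · have hγ1 : γ = 1 := le_antisymm h2 (not_lt.mp hlt)
      subst hγ1
      have hn : ¬ (IsAlgebraic ℚ (1 : ℝ) ∧ -1 ≤ (1 : ℝ) ∧ (1 : ℝ) < 1) := fun h => lt_irrefl _ h.2.2
      simp only [dif_neg hn, KZ.IntegralRep.domain_empty]
      refine ⟨?_, fun p hp => hp.elim⟩
      rw [hV]
      ext p
      simp only [mem_empty_iff_false, mem_setOf_eq, false_iff, not_and]
      intro h h' _
      linarith
  obtain ⟨S, hS⟩ := key
  have hdom : ∀ γ, IsAlgebraic ℚ γ → -1 ≤ γ → γ ≤ 1 → (S γ).domain = V γ 1 0 1 :=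
    fun γ h h1 h2 => (hS γ h h1 h2).1
  have hint : ∀ γ, IsAlgebraic ℚ γ → -1 ≤ γ → γ ≤ 1 →
      EqOn (S γ).integrand (fun p => 1 / p 1 ^ 2) (S γ).domain := fun γ h h1 h2 => (hS γ h h1 h2).2
  have hvalS : ∀ γ, IsAlgebraic ℚ γ → -1 ≤ γ → γ ≤ 1 → (S γ).value = arccos γ :=
    fun γ h h1 h2 => hVal γ h1 h2 (S γ) (hdom γ h h1 h2) (hint γ h h1 h2)
  /- the three-triangle relation and `[S 1] ∈ relations` for this family -/
  have hT' : ∀ a b : ℝ, IsAlgebraic ℚ a → IsAlgebraic ℚ b → -1 < a → a < 1 → -1 < b → b < 1 → 0 ≤ a + b →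
      KZ.of (S a) + KZ.of (S b) + KZ.of (S (Real.sqrt (1 - a ^ 2) * Real.sqrt (1 - b ^ 2) - a * b)) -
        KZ.of (S (-1)) ∈ KZ.relations := by
    intro a b ha hb ha1 ha2 hb1 hb2 hab
    have hcalg : IsAlgebraic ℚ (Real.sqrt (1 - a ^ 2) * Real.sqrt (1 - b ^ 2) - a * b) :=
      ((rungZero_isAlgebraic_sqrt (isAlgebraic_one.sub (ha.pow 2))).mul
        (rungZero_isAlgebraic_sqrt (isAlgebraic_one.sub (hb.pow 2)))).sub (ha.mul hb)
    obtain ⟨hc1, hc2⟩ := angleKernel_third_mem ha1.le ha2.le hb1.le hb2.le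
    have hm1 : IsAlgebraic ℚ (-1 : ℝ) := isAlgebraic_one.neg
    exact hT a b ha hb ha1 ha2 hb1 hb2 hab (S a) (S b) (S _) (S (-1))
      (hdom a ha ha1.le ha2.le) (hint a ha ha1.le ha2.le) (hdom b hb hb1.le hb2.le) (hint b hb hb1.le hb2.le)
      (hdom _ hcalg hc1 hc2) (hint _ hcalg hc1 hc2) (hdom (-1) hm1 le_rfl (by norm_num))
      (hint (-1) hm1 le_rfl (by norm_num))
  have h1 : KZ.of (S 1) ∈ KZ.relations := by
    refine KZ.of_mem_relations_of_volume_eq_zero _ ?_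
    rw [hdom 1 isAlgebraic_one (by norm_num) le_rfl, hV]
    convert measure_empty (μ := (volume : Measure (Fin 2 → ℝ)))
    ext p
    simp only [mem_setOf_eq, mem_empty_iff_false, iff_false, not_and]
    intro h h' _
    linarith
  /- normal form of each piece: `[W l] ≡ [S α'ₗ] − [S β'ₗ]` -/
  set α' : ι → ℝ := fun l => (α l - a l) * (Real.sqrt (c l))⁻¹ with hα'
  set β' : ι → ℝ := fun l => (β l - a l) * (Real.sqrt (c l))⁻¹ with hβ'
  have hcpos : ∀ l, 0 < c l := fun l => vPiece_c_pos (hdata l).2.2.2.2.1 (hdata l).2.2.2.2.2.1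
    (hdata l).2.2.2.2.2.2
  have hα'mem : ∀ l, -1 ≤ α' l ∧ α' l ≤ 1 := fun l => angleKernel_normalised_mem (hcpos l) (hdata l).2.2.2.2.2.1
  have hβ'mem : ∀ l, -1 ≤ β' l ∧ β' l ≤ 1 := fun l => angleKernel_normalised_mem (hcpos l) (hdata l).2.2.2.2.2.2
  have hlt' : ∀ l, α' l < β' l := fun l =>
    mul_lt_mul_of_pos_right (by linarith [(hdata l).2.2.2.2.1])
      (inv_pos.mpr (Real.sqrt_pos.mpr (hcpos l)))
  have hsalg : ∀ l, IsAlgebraic ℚ (Real.sqrt (c l))⁻¹ := fun l =>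
    (rungZero_isAlgebraic_sqrt (hdata l).2.2.2.1).inv
  have hα'alg : ∀ l, IsAlgebraic ℚ (α' l) := fun l => ((hdata l).1.sub (hdata l).2.2.1).mul (hsalg l)
  have hβ'alg : ∀ l, IsAlgebraic ℚ (β' l) := fun l => ((hdata l).2.1.sub (hdata l).2.2.1).mul (hsalg l)
  -- representations of the normalised pieces
  have hr'ex : ∀ l, ∃ r' : KZ.IntegralRep 2, r'.domain = V (α' l) (β' l) 0 1 ∧
      r'.integrand = fun p => 1 / p 1 ^ 2 := fun l =>
    hRep (α' l) (β' l) 0 1 (hα'alg l) (hβ'alg l) isAlgebraic_zero isAlgebraic_one (hlt' l)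
      (by rw [sub_zero]; nlinarith [(hα'mem l).1, (hα'mem l).2])
      (by rw [sub_zero]; nlinarith [(hβ'mem l).1, (hβ'mem l).2])
  choose r' hr'd hr'i using hr'ex
  have hpiece : ∀ l, KZ.of (W l) - (KZ.of (S (α' l)) - KZ.of (S (β' l))) ∈ KZ.relations := by
    intro l
    have e1 : KZ.of (W l) - KZ.of (r' l) ∈ KZ.relations :=
      angleKernel_equivalent_normalised hV (hcpos l) (hdata l).2.2.1 (hdata l).2.2.2.1 (W l) (r' l)
        (hW l).1 (hW l).2 (hr'd l) (fun p _ => by rw [hr'i l])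
    have e2 : KZ.of (S (α' l)) - KZ.of (r' l) - KZ.of (S (β' l)) ∈ KZ.relations :=
      angleKernel_split_std hV (hlt' l) (hβ'mem l).2 (S (α' l)) (r' l) (S (β' l))
        (hdom _ (hα'alg l) (hα'mem l).1 (hα'mem l).2) (hint _ (hα'alg l) (hα'mem l).1 (hα'mem l).2)
        (hr'd l) (fun p _ => by rw [hr'i l])
        (hdom _ (hβ'alg l) (hβ'mem l).1 (hβ'mem l).2) (hint _ (hβ'alg l) (hβ'mem l).1 (hβ'mem l).2)
    have : KZ.of (W l) - (KZ.of (S (α' l)) - KZ.of (S (β' l))) =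
        (KZ.of (W l) - KZ.of (r' l)) - (KZ.of (S (α' l)) - KZ.of (r' l) - KZ.of (S (β' l))) := by abel
    rw [this]
    exact sub_mem e1 e2
  -- values
  have hvalW : ∀ l, (W l).value = arccos (α' l) - arccos (β' l) := by
    intro l
    have h0 := KZ.relations_le_ker_eval_holds (hpiece l)
    rw [AddMonoidHom.mem_ker, map_sub, map_sub, KZ.eval_of, KZ.eval_of, KZ.eval_of,
      hvalS _ (hα'alg l) (hα'mem l).1 (hα'mem l).2, hvalS _ (hβ'alg l) (hβ'mem l).1 (hβ'mem l).2] at h0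
    linarith
  /- the angle kernel over `ι ⊕ ι` -/
  have hk := angleKernel_std_kernel_aux (S := S) hT' h1 (κ := ι ⊕ ι) (Sum.elim α' β')
    (Sum.elim E (fun l => -E l)) (by
      rintro (l | l)
      · exact ⟨hα'alg l, (hα'mem l).1, (hα'mem l).2⟩
      · exact ⟨hβ'alg l, (hβ'mem l).1, (hβ'mem l).2⟩) (by
      rw [Fintype.sum_sum_type]
      simp only [Sum.elim_inl, Sum.elim_inr, Int.cast_neg, neg_mul, Finset.sum_neg_distrib]
      rw [← sub_eq_add_neg, ← Finset.sum_sub_distrib, ← hsum]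
      refine Finset.sum_congr rfl fun l _ => ?_
      rw [hvalW l]
      ring)
  rw [Fintype.sum_sum_type] at hk
  simp only [Sum.elim_inl, Sum.elim_inr, neg_smul, Finset.sum_neg_distrib] at hk
  have hsplit : ∑ l, E l • KZ.of (W l) =
      ∑ l, E l • (KZ.of (W l) - (KZ.of (S (α' l)) - KZ.of (S (β' l)))) +
      (∑ l, E l • KZ.of (S (α' l)) + -∑ l, E l • KZ.of (S (β' l))) := by
    simp only [smul_sub, Finset.sum_sub_distrib]
    abel
  rw [hsplit]
  exact add_mem (sum_mem fun l _ => zsmul_mem (hpiece l) _) hk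

end Summit.KontsevichZagierPeriods.HyperbolicBloch.OffTetraSectorKernel

end
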